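import Summits.KontsevichZagierPeriods.KontsevichZagierPeriods.Theorems.TerasomaMultiplicationMultiplicationAccessibleTranslateX

/-!
# `MultiplicationAccessible` (stmt-KontsevichZagierPeriods-12305), line `shifted-family-prime-sieve`:
the `s`-TRANSLATION of the shifted triplication family — `GM(2; x, s+1) → GM(2; x, s)`

The shifted Gauss-multiplication family at `n = 3` (`m = 2`), `GM(2; x, s)`: every box representation
of `B(x,s)B(x+⅓,s)B(x+⅔,s)` (integrand `∏ₖ zₖ^(x+k/3−1)(1−zₖ)^(s−1)` on `(0,1)³`) is equivalent, under
the moves of Kontsevich–Zagier 2001 §1.2, to every box representation of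
`3^(3s) B(3x,3s) B(s,s) B(2s,s)` (pinned exactly as `GM 2 x s` of the line, i.e. the `m = 2` case of
the hypothesis shape of `gm_glue` in `Theorems/TerasomaMultiplicationMultiplicationAccessibleSieve.lean`).
This file proves the registered sub-goal `gmTwo_of_gmTwo_succ_s`: **`GM(2; x, s+1)` implies
`GM(2; x, s)`** for rational `x, s > 0` — so the family for all `s > 0` follows from the family for
`s > S₀` (apply the lemma `⌈S₀⌉` times), which is what the Liouville rotation-flow Stokes argument
(valid for large `s`) supplies.

Everything is book-keeping in the formal period ring `P = KZ.FormalPeriodRing` with the Beta classes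
`g(p,q) = ⟦β(p,q)⟧` of a pinned Beta family (`MultGlue.exists_betaFamily`) and the rational point
constants `⟦[pt, q]⟧`, `q ∈ ℚ`, of the `x`-translation file
`Theorems/TerasomaMultiplicationMultiplicationAccessibleTranslateX.lean` (multiplicative,
`TranslateX.ptQ_mul`; a nonzero one is a unit, `TranslateX.ptQ_cancel`):
* the translations `⟦a+b⟧ g(a, b+1) = ⟦b⟧ g(a,b)` and `⟦a+b⟧ g(a+1, b) = ⟦a⟧ g(a,b)` are ONE
  Newton–Leibniz move each (`KZ.betaTranslation_equivalent`; `TranslateX.transl_snd_eq`,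
  `TranslateX.transl_fst_eq`), here solved for `g(a,b+1) = ⟦b/(a+b)⟧ g(a,b)` and
  `g(a+1,b) = ⟦a/(a+b)⟧ g(a,b)` (`TranslateS.solve_eq`, `transl_snd_solved`, `transl_fst_solved`);
* the pinned `GM(m; x, s)` is the identity `⟦1⟧ ∏ₖ g(x+k/n, s) = ⟦n^(ns)⟧ g(nx,ns) ∏_(j<m) g((j+1)s, s)`
  in `P` (`TranslateX.prod_eq_of_pinned`) and conversely (`TranslateS.pinned_of_prod_eq`:
  `MultGlue.equiv_of_prod_eq`, `MultGlue.equivalent_of_equiv`);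
* from `s+1` to `s` (`gm_prod_eq_step`): three translations on the left (`g(x+k/3, s+1) → g(x+k/3, s)`),
  eight on the right (`g(3x, 3s+3) → g(3x, 3s)` thrice in the second argument; `g(s+1,s+1) → g(s,s)`;
  `g(2s+2, s+1) → g(2s, s)`), the constant `3^(3(s+1)) = 27·3^(3s)` (`Real.rpow_add`), and the rational
  identity `27(3s+2)(3s+1)(3s)·s²·s(2s+1)(2s) / [(3x+3s+2)(3x+3s+1)(3x+3s)(2s+1)(2s)(3s+2)(3s+1)(3s)]
  = s³/[(x+s)(x+s+⅓)(x+s+⅔)]` (`field_simp; ring`), after which one nonzero rational constant cancels.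
References: Kontsevich–Zagier 2001 §1.2, §4.1; Andrews–Askey–Roy 1999, §1.1
(`B(u, v+1) = B(u,v)·v/(u+v)`), Thm 1.5.2 (Gauss multiplication).
-/

noncomputable section

open MeasureTheory Set Finset
open scoped BigOperators
open Literature.NumberTheory.Transcendental
open Literature.NumberTheory.Transcendental.KZ

namespace Summit.KontsevichZagierPeriods.TerasomaMultiplication.MultiplicationAccessible

namespace TranslateS

open TranslateX

/-! ## Solved translations of Beta classes in `P` -/

/-- **Solving for a nonzero rational point constant**: `⟦[pt,u]⟧ X = ⟦[pt,v]⟧ Y` with `u ≠ 0` gives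
`X = ⟦[pt, v/u]⟧ Y` (`⟦[pt,u⁻¹]⟧⟦[pt,u]⟧ = 1`, `TranslateX.ptQ_mul`, `TranslateX.ptQ_one`). [folklore] -/
theorem solve_eq {u v : ℚ} (hu : u ≠ 0) {X Y : FormalPeriodRing}
    (h : toFormalPeriod (of (IntegralRep.unit.constMul _ (isAlgebraic_ratCast u))) * X =
      toFormalPeriod (of (IntegralRep.unit.constMul _ (isAlgebraic_ratCast v))) * Y) :
    X = toFormalPeriod (of (IntegralRep.unit.constMul _ (isAlgebraic_ratCast (v / u)))) * Y := by
  have hinv : toFormalPeriod (of (IntegralRep.unit.constMul _ (isAlgebraic_ratCast u⁻¹))) *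
      toFormalPeriod (of (IntegralRep.unit.constMul _ (isAlgebraic_ratCast u))) = 1 := by
    rw [← ptQ_mul, inv_mul_cancel₀ hu, ptQ_one]
  rw [div_eq_inv_mul, ptQ_mul]
  linear_combination toFormalPeriod (of (IntegralRep.unit.constMul _ (isAlgebraic_ratCast u⁻¹))) * h
    - X * hinv

/-- **Translation in the second argument, solved**: `g(a, b+1) = ⟦[pt, b/(a+b)]⟧ g(a, b)` for rational
`a, b > 0` (`TranslateX.transl_snd_eq`, ONE Newton–Leibniz move; the argument `b1 = b + 1` may be
spelled freely). [cite: AndrewsAskeyRoy1999, §1.1] -/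
theorem transl_snd_solved {B : ℚ → ℚ → IntegralRep 1}
    (hB : ∀ p q, 0 < p → 0 < q → (B p q).domain = {t | t 0 ∈ Set.Ioo (0:ℝ) 1} ∧
      (B p q).integrand = fun t => (t 0) ^ ((p:ℝ) - 1) * (1 - t 0) ^ ((q:ℝ) - 1))
    {a b : ℚ} (ha : 0 < a) (hb : 0 < b) (b1 : ℚ) (hb1 : b1 = b + 1) :
    toFormalPeriod (of (B a b1)) =
      toFormalPeriod (of (IntegralRep.unit.constMul _
        (isAlgebraic_ratCast (b / (a + b))))) * toFormalPeriod (of (B a b)) := by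
  subst hb1
  exact solve_eq (add_pos ha hb).ne' (transl_snd_eq hB ha hb)

/-- **Translation in the first argument, solved**: `g(a+1, b) = ⟦[pt, a/(a+b)]⟧ g(a, b)` for rational
`a, b > 0` (`TranslateX.transl_fst_eq`; the argument `a1 = a + 1` may be spelled freely).
[cite: AndrewsAskeyRoy1999, §1.1] -/
theorem transl_fst_solved {B : ℚ → ℚ → IntegralRep 1}
    (hB : ∀ p q, 0 < p → 0 < q → (B p q).domain = {t | t 0 ∈ Set.Ioo (0:ℝ) 1} ∧
      (B p q).integrand = fun t => (t 0) ^ ((p:ℝ) - 1) * (1 - t 0) ^ ((q:ℝ) - 1))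
    {a b : ℚ} (ha : 0 < a) (hb : 0 < b) (a1 : ℚ) (ha1 : a1 = a + 1) :
    toFormalPeriod (of (B a1 b)) =
      toFormalPeriod (of (IntegralRep.unit.constMul _
        (isAlgebraic_ratCast (a / (a + b))))) * toFormalPeriod (of (B a b)) := by
  subst ha1
  exact solve_eq (add_pos ha hb).ne' (transl_fst_eq hB ha hb)

/-! ## Unfolding the two three-fold products -/

/-- `∏_(k<3) g(x + k/c, t) = g(x,t) · (g(x + 1/c, t) · g(x + 2/c, t))`. [folklore] -/
theorem prod_three_shift (B : ℚ → ℚ → IntegralRep 1) (x c t : ℚ) :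
    ∏ k : Fin (2 + 1), toFormalPeriod (of (B (x + (k : ℚ) / c) t)) =
      toFormalPeriod (of (B x t)) *
        (toFormalPeriod (of (B (x + 1 / c) t)) * toFormalPeriod (of (B (x + 2 / c) t))) := by
  rw [Fin.prod_univ_succ, Fin.prod_univ_succ, Fin.prod_univ_one]
  simp only [Fin.val_zero, Fin.val_succ, Nat.cast_zero, zero_div, add_zero, zero_add,
    Nat.cast_one, one_add_one_eq_two, Nat.cast_ofNat]

/-- `∏_(k<3) g(α'_k, β'_k) = g(X, Y) · (g(1·t, t) · g(2·t, t))` for the right-hand exponent vectors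
`α' = (X, 1·t, 2·t)`, `β' = (Y, t, t)`. [folklore] -/
theorem prod_three_ite (B : ℚ → ℚ → IntegralRep 1) (X Y t : ℚ) :
    ∏ k : Fin (2 + 1), toFormalPeriod (of (B (if (k : ℕ) = 0 then X else (k : ℚ) * t)
        (if (k : ℕ) = 0 then Y else t))) =
      toFormalPeriod (of (B X Y)) *
        (toFormalPeriod (of (B (1 * t) t)) * toFormalPeriod (of (B (2 * t) t))) := by
  rw [Fin.prod_univ_succ, Fin.prod_univ_succ, Fin.prod_univ_one]
  simp (decide := true) only [Fin.val_zero, Fin.val_succ, if_true, if_false, zero_add, Nat.cast_one,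
    Nat.cast_ofNat, Nat.reduceAdd]

/-! ## From the identity in `P` back to the pinned family -/

/-- **The identity in `P` gives pinned `GM(m; x, s)`**: every box representation of the left is
equivalent to every box representation of the right (`MultGlue.equiv_of_prod_eq`,
`MultGlue.equivalent_of_equiv`, `GlueFromParts.gmLeft_eq`, `GlueFromParts.gmRight_eq`).
[cite: AndrewsAskeyRoy1999, Thm 1.5.2] -/
theorem pinned_of_prod_eq {B : ℚ → ℚ → IntegralRep 1}
    (hB : ∀ p q, 0 < p → 0 < q → (B p q).domain = {t | t 0 ∈ Set.Ioo (0:ℝ) 1} ∧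
      (B p q).integrand = fun t => (t 0) ^ ((p:ℝ) - 1) * (1 - t 0) ^ ((q:ℝ) - 1))
    (m : ℕ) {x s : ℚ} (hx : 0 < x) (hs : 0 < s)
    (hP : toFormalPeriod (of (IntegralRep.unit.constMul (1:ℝ) isAlgebraic_one)) *
        ∏ k : Fin (m + 1), toFormalPeriod (of (B (x + (k : ℚ) / ((m : ℚ) + 1)) s)) =
      toFormalPeriod (of (IntegralRep.unit.constMul (((m:ℝ) + 1) ^ (((m:ℝ) + 1) * (s:ℝ)))
        (MultGlue.isAlgebraic_gaussConst m s))) *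
        ∏ k : Fin (m + 1), toFormalPeriod (of (B
          (if (k : ℕ) = 0 then ((m : ℚ) + 1) * x else (k : ℚ) * s)
          (if (k : ℕ) = 0 then ((m : ℚ) + 1) * s else s)))) :
    ∀ (r r' : KZ.IntegralRep (m + 1)),
        r.domain = {z | ∀ i, z i ∈ Set.Ioo (0:ℝ) 1} →
        Set.EqOn r.integrand (fun z => ∏ k : Fin (m + 1),
          (z k) ^ ((x:ℝ) + ((k:ℕ):ℝ) / ((m:ℝ) + 1) - 1) * (1 - z k) ^ ((s:ℝ) - 1)) r.domain →
        r'.domain = {z | ∀ i, z i ∈ Set.Ioo (0:ℝ) 1} →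
        Set.EqOn r'.integrand (fun z => ((m:ℝ) + 1) ^ (((m:ℝ) + 1) * (s:ℝ)) *
          ((z 0) ^ (((m:ℝ) + 1) * (x:ℝ) - 1) * (1 - z 0) ^ (((m:ℝ) + 1) * (s:ℝ) - 1)) *
          ∏ j : Fin m, (z j.succ) ^ ((((j:ℕ):ℝ) + 1) * (s:ℝ) - 1) * (1 - z j.succ) ^ ((s:ℝ) - 1))
          r'.domain →
        KZ.Equivalent r r' := by
  intro r r' hr hri hr' hri'
  have hex := MultGlue.equiv_of_prod_eq hB isAlgebraic_one (MultGlue.isAlgebraic_gaussConst m s)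
    (α := fun k : Fin (m + 1) => x + (k : ℚ) / ((m : ℚ) + 1)) (β := fun _ => s)
    (α' := fun k : Fin (m + 1) => if (k : ℕ) = 0 then ((m : ℚ) + 1) * x else (k : ℚ) * s)
    (β' := fun k : Fin (m + 1) => if (k : ℕ) = 0 then ((m : ℚ) + 1) * s else s)
    (fun k => by positivity) (fun _ => hs)
    (fun k => by split_ifs with h; exacts [by positivity, MultGlue.natCast_mul_pos h hs])
    (fun k => by split_ifs <;> positivity) hP
  exact MultGlue.equivalent_of_equiv hex r r' hr
    (fun z hz => (hri hz).trans (GlueFromParts.gmLeft_eq m x s z).symm) hr'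
    (fun z hz => (hri' hz).trans (GlueFromParts.gmRight_eq m x s z).symm)

/-! ## From `s + 1` to `s` in `P` (`m = 2`) -/

/-- The constants: `3^(3(s+1)) = 27 · 3^(3s)` (`Real.rpow_add`, `Real.rpow_natCast`). [folklore] -/
theorem gaussConst_succ_eq (s : ℚ) :
    (((2:ℕ):ℝ) + 1) ^ ((((2:ℕ):ℝ) + 1) * (((s + 1 : ℚ)) : ℝ)) =
      ((27:ℚ):ℝ) * ((((2:ℕ):ℝ) + 1) ^ ((((2:ℕ):ℝ) + 1) * (s:ℝ))) := by
  have h3 : (0:ℝ) < ((2:ℕ):ℝ) + 1 := by positivity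
  rw [show (((2:ℕ):ℝ) + 1) * (((s + 1 : ℚ)) : ℝ) = (((2:ℕ):ℝ) + 1) * (s:ℝ) + ((3:ℕ):ℝ) by
      push_cast; ring,
    Real.rpow_add h3, Real.rpow_natCast]
  push_cast
  ring

/-- **`GM(2)` in `P` at `s + 1` gives `GM(2)` in `P` at `s`**: three translations on the left, eight on
the right, the constant `3^(3(s+1)) = ⟦27⟧ 3^(3s)`, one rational identity, and the cancellation of a
nonzero rational point constant. [cite: AndrewsAskeyRoy1999, Thm 1.5.2] -/
theorem gm_prod_eq_step {B : ℚ → ℚ → IntegralRep 1}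
    (hB : ∀ p q, 0 < p → 0 < q → (B p q).domain = {t | t 0 ∈ Set.Ioo (0:ℝ) 1} ∧
      (B p q).integrand = fun t => (t 0) ^ ((p:ℝ) - 1) * (1 - t 0) ^ ((q:ℝ) - 1))
    {x s : ℚ} (hx : 0 < x) (hs : 0 < s)
    (h1 : toFormalPeriod (of (IntegralRep.unit.constMul (1:ℝ) isAlgebraic_one)) *
        ∏ k : Fin (2 + 1), toFormalPeriod (of (B (x + (k : ℚ) / (((2:ℕ) : ℚ) + 1)) (s + 1))) =
      toFormalPeriod (of (IntegralRep.unit.constMul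
        ((((2:ℕ):ℝ) + 1) ^ ((((2:ℕ):ℝ) + 1) * (((s + 1 : ℚ)) : ℝ)))
        (MultGlue.isAlgebraic_gaussConst 2 (s + 1)))) *
        ∏ k : Fin (2 + 1), toFormalPeriod (of (B
          (if (k : ℕ) = 0 then (((2:ℕ) : ℚ) + 1) * x else (k : ℚ) * (s + 1))
          (if (k : ℕ) = 0 then (((2:ℕ) : ℚ) + 1) * (s + 1) else (s + 1))))) :
    toFormalPeriod (of (IntegralRep.unit.constMul (1:ℝ) isAlgebraic_one)) *
        ∏ k : Fin (2 + 1), toFormalPeriod (of (B (x + (k : ℚ) / (((2:ℕ) : ℚ) + 1)) s)) =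
      toFormalPeriod (of (IntegralRep.unit.constMul
        ((((2:ℕ):ℝ) + 1) ^ ((((2:ℕ):ℝ) + 1) * (s:ℝ))) (MultGlue.isAlgebraic_gaussConst 2 s))) *
        ∏ k : Fin (2 + 1), toFormalPeriod (of (B
          (if (k : ℕ) = 0 then (((2:ℕ) : ℚ) + 1) * x else (k : ℚ) * s)
          (if (k : ℕ) = 0 then (((2:ℕ) : ℚ) + 1) * s else s))) := by
  rw [prod_three_shift, prod_three_ite] at h1 ⊢
  -- the three left translations `g(x + k/3, s+1) = ⟦s/(x+k/3+s)⟧ g(x + k/3, s)`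
  have tA0 := transl_snd_solved hB hx hs (s + 1) rfl
  have tA1 := transl_snd_solved hB (a := x + 1 / (((2:ℕ):ℚ) + 1)) (by positivity) hs (s + 1) rfl
  have tA2 := transl_snd_solved hB (a := x + 2 / (((2:ℕ):ℚ) + 1)) (by positivity) hs (s + 1) rfl
  -- `g(3x, 3(s+1)) → g(3x, 3s+2) → g(3x, 3s+1) → g(3x, 3s)`
  have tR01 := transl_snd_solved hB (a := (((2:ℕ):ℚ) + 1) * x) (b := (((2:ℕ):ℚ) + 1) * s + 2)
    (by positivity) (by positivity) ((((2:ℕ):ℚ) + 1) * (s + 1)) (by push_cast; ring)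
  have tR02 := transl_snd_solved hB (a := (((2:ℕ):ℚ) + 1) * x) (b := (((2:ℕ):ℚ) + 1) * s + 1)
    (by positivity) (by positivity) ((((2:ℕ):ℚ) + 1) * s + 2) (by ring)
  have tR03 := transl_snd_solved hB (a := (((2:ℕ):ℚ) + 1) * x) (b := (((2:ℕ):ℚ) + 1) * s)
    (by positivity) (by positivity) ((((2:ℕ):ℚ) + 1) * s + 1) rfl
  -- `g(1·(s+1), s+1) → g(1·(s+1), s) → g(1·s, s)`
  have tR11 := transl_snd_solved hB (a := 1 * (s + 1)) (b := s) (by positivity) hs (s + 1) rfl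
  have tR12 := transl_fst_solved hB (a := 1 * s) (b := s) (by positivity) hs (1 * (s + 1)) (by ring)
  -- `g(2(s+1), s+1) → g(2(s+1), s) → g(2s+1, s) → g(2s, s)`
  have tR21 := transl_snd_solved hB (a := 2 * (s + 1)) (b := s) (by positivity) hs (s + 1) rfl
  have tR22 := transl_fst_solved hB (a := 2 * s + 1) (b := s) (by positivity) hs (2 * (s + 1))
    (by ring)
  have tR23 := transl_fst_solved hB (a := 2 * s) (b := s) (by positivity) hs (2 * s + 1) rfl
  -- the constant `3^(3(s+1)) = ⟦27⟧ 3^(3s)`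
  have hC : toFormalPeriod (of (IntegralRep.unit.constMul
        ((((2:ℕ):ℝ) + 1) ^ ((((2:ℕ):ℝ) + 1) * (((s + 1 : ℚ)) : ℝ)))
        (MultGlue.isAlgebraic_gaussConst 2 (s + 1)))) =
      toFormalPeriod (of (IntegralRep.unit.constMul _ (isAlgebraic_ratCast 27))) *
        toFormalPeriod (of (IntegralRep.unit.constMul
          ((((2:ℕ):ℝ) + 1) ^ ((((2:ℕ):ℝ) + 1) * (s:ℝ))) (MultGlue.isAlgebraic_gaussConst 2 s))) := by
    rw [← MultGlue.ptConst_mul (isAlgebraic_ratCast 27) (MultGlue.isAlgebraic_gaussConst 2 s)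
      ((isAlgebraic_ratCast 27).mul (MultGlue.isAlgebraic_gaussConst 2 s))]
    exact MultGlue.ptConst_congr _ _ (gaussConst_succ_eq s)
  rw [tA0, tA1, tA2, tR01, tR02, tR03, tR11, tR12, tR21, tR22, tR23, hC] at h1
  -- collect the rational constants on both sides
  have key : toFormalPeriod (of (IntegralRep.unit.constMul _ (isAlgebraic_ratCast
        (s / (x + s) * (s / (x + 1 / (((2:ℕ):ℚ) + 1) + s)) *
          (s / (x + 2 / (((2:ℕ):ℚ) + 1) + s)))))) *
      (toFormalPeriod (of (IntegralRep.unit.constMul (1:ℝ) isAlgebraic_one)) *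
        (toFormalPeriod (of (B x s)) * (toFormalPeriod (of (B (x + 1 / (((2:ℕ):ℚ) + 1)) s)) *
          toFormalPeriod (of (B (x + 2 / (((2:ℕ):ℚ) + 1)) s))))) =
      toFormalPeriod (of (IntegralRep.unit.constMul _ (isAlgebraic_ratCast
        (27 * (((((2:ℕ):ℚ) + 1) * s + 2) / ((((2:ℕ):ℚ) + 1) * x + ((((2:ℕ):ℚ) + 1) * s + 2))) *
          (((((2:ℕ):ℚ) + 1) * s + 1) / ((((2:ℕ):ℚ) + 1) * x + ((((2:ℕ):ℚ) + 1) * s + 1))) *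
          ((((2:ℕ):ℚ) + 1) * s / ((((2:ℕ):ℚ) + 1) * x + (((2:ℕ):ℚ) + 1) * s)) *
          (s / (1 * (s + 1) + s)) * (1 * s / (1 * s + s)) *
          (s / (2 * (s + 1) + s)) * ((2 * s + 1) / (2 * s + 1 + s)) * (2 * s / (2 * s + s)))))) *
      (toFormalPeriod (of (IntegralRep.unit.constMul
          ((((2:ℕ):ℝ) + 1) ^ ((((2:ℕ):ℝ) + 1) * (s:ℝ))) (MultGlue.isAlgebraic_gaussConst 2 s))) *
        (toFormalPeriod (of (B ((((2:ℕ):ℚ) + 1) * x) ((((2:ℕ):ℚ) + 1) * s))) *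
          (toFormalPeriod (of (B (1 * s) s)) * toFormalPeriod (of (B (2 * s) s))))) := by
    simp only [ptQ_mul]
    linear_combination h1
  -- the two rational constants agree, and a nonzero rational point constant cancels
  have hconst :
      27 * (((((2:ℕ):ℚ) + 1) * s + 2) / ((((2:ℕ):ℚ) + 1) * x + ((((2:ℕ):ℚ) + 1) * s + 2))) *
        (((((2:ℕ):ℚ) + 1) * s + 1) / ((((2:ℕ):ℚ) + 1) * x + ((((2:ℕ):ℚ) + 1) * s + 1))) *
        ((((2:ℕ):ℚ) + 1) * s / ((((2:ℕ):ℚ) + 1) * x + (((2:ℕ):ℚ) + 1) * s)) *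
        (s / (1 * (s + 1) + s)) * (1 * s / (1 * s + s)) *
        (s / (2 * (s + 1) + s)) * ((2 * s + 1) / (2 * s + 1 + s)) * (2 * s / (2 * s + s)) =
      s / (x + s) * (s / (x + 1 / (((2:ℕ):ℚ) + 1) + s)) * (s / (x + 2 / (((2:ℕ):ℚ) + 1) + s)) := by
    rw [show ((2:ℕ):ℚ) + 1 = 3 by norm_num]
    field_simp
    ring
  rw [hconst] at key
  exact ptQ_cancel (by positivity) key

end TranslateS

/-- **Registered sub-goal `gmTwo_of_gmTwo_succ_s`** (the `s`-translation of the shifted family at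
`p = 3`): for rational `x, s > 0`, the shifted Gauss triplication `GM(2; x, s+1)` inside the
Kontsevich–Zagier rules (pinned form: every box representation of `B(x,·)B(x+⅓,·)B(x+⅔,·)` is
equivalent to every box representation of `3^(3·) B(3x, 3·) B(·,·) B(2·,·)`) implies `GM(2; x, s)` —
in the formal period ring the two differ by `3 + 8` translations `B(u, v+1) = B(u,v)·v/(u+v)` (one
Newton–Leibniz move each, `KZ.betaTranslation_equivalent`), the constant `3^(3(s+1)) = 27·3^(3s)`, and
a nonzero rational point constant, which is a unit (`TranslateS.gm_prod_eq_step`); the pinned forms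
are converted by `TranslateX.prod_eq_of_pinned` / `TranslateS.pinned_of_prod_eq`.
[cite: AndrewsAskeyRoy1999, Thm 1.5.2] -/
theorem gmTwo_of_gmTwo_succ_s : ∀ (x s : ℚ), 0 < x → 0 < s → (∀ (r r' : KZ.IntegralRep (2 + 1)), r.domain = {z | ∀ i, z i ∈ Set.Ioo (0:ℝ) 1} → Set.EqOn r.integrand (fun z => ∏ k : Fin (2 + 1), (z k) ^ ((x:ℝ) + ((k:ℕ):ℝ) / (((2:ℕ):ℝ) + 1) - 1) * (1 - z k) ^ ((((s + 1 : ℚ)):ℝ) - 1)) r.domain → r'.domain = {z | ∀ i, z i ∈ Set.Ioo (0:ℝ) 1} → Set.EqOn r'.integrand (fun z => (((2:ℕ):ℝ) + 1) ^ ((((2:ℕ):ℝ) + 1) * (((s + 1 : ℚ)):ℝ)) * ((z 0) ^ ((((2:ℕ):ℝ) + 1) * (x:ℝ) - 1) * (1 - z 0) ^ ((((2:ℕ):ℝ) + 1) * (((s + 1 : ℚ)):ℝ) - 1)) * ∏ j : Fin 2, (z j.succ) ^ ((((j:ℕ):ℝ) + 1) * (((s + 1 : ℚ)):ℝ) - 1)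 * (1 - z j.succ) ^ ((((s + 1 : ℚ)):ℝ) - 1)) r'.domain → KZ.Equivalent r r') → ∀ (r r' : KZ.IntegralRep (2 + 1)), r.domain = {z | ∀ i, z i ∈ Set.Ioo (0:ℝ) 1} → Set.EqOn r.integrand (fun z => ∏ k : Fin (2 + 1), (z k) ^ ((x:ℝ) + ((k:ℕ):ℝ) / (((2:ℕ):ℝ) + 1) - 1) * (1 - z k) ^ ((s:ℝ) - 1)) r.domain → r'.domain = {z | ∀ i, z i ∈ Set.Ioo (0:ℝ) 1} → Set.EqOn r'.integrand (fun z => (((2:ℕ):ℝ) + 1) ^ ((((2:ℕ):ℝ) + 1) * (s:ℝ)) * ((z 0) ^ ((((2:ℕ):ℝ) + 1) * (x:ℝ) - 1) * (1 - z 0) ^ ((((2:ℕ):ℝ) + 1) * (s:ℝ) - 1)) * ∏ j : Fin 2, (z j.succ) ^ ((((j:ℕ):ℝ) + 1) * (s:ℝ) - 1) * (1 - z j.succ) ^ ((s:ℝ) - 1)) r'.domain → KZ.Equivalent r r' := by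
  intro x s hx hs hGM
  obtain ⟨B, hB⟩ := MultGlue.exists_betaFamily
  have hs1 : (0:ℚ) < s + 1 := by positivity
  exact TranslateS.pinned_of_prod_eq hB 2 hx hs
    (TranslateS.gm_prod_eq_step hB hx hs (TranslateX.prod_eq_of_pinned hB 2 hx hs1 hGM))

end Summit.KontsevichZagierPeriods.TerasomaMultiplication.MultiplicationAccessible

end
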